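import Summits.CriticalPhenomena.PercolationContinuityZ3.Theorems.PercNearOneGluingNoHeavyLowerTailSahiThreeCopyCylinder

/-!
# `NoHeavyLowerTail` (crux stmt-CriticalPhenomena-4575), Sahi programme: **the three-copy functional of three COORDINATE PRODUCTS
# FACTORISES over the coordinates** — `N_b(Π(α+βx); Π(α'+β'x); Π(α''+β''x)) = Π_i L(b_i; …)` — infrastructure for the next class of
# 3C-SAHI (three OR-events / the three-cylinder sandwich, memo FROM-prim-sahi-p1-gen53 §9)

Support file (Sahi cell, seat `prim-sahi-p1`, generation 53; `--supports stmt-CriticalPhenomena-4575`); companion of `…SahiThreeCopyCylinder`.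
Pure proofs plus one bookkeeping definition (`locN3`, the one-coordinate three-copy sum); no `sorry`, standard axioms.

* `cprod_mul`: coordinate products are closed under multiplication (`x_i² = x_i`):
  `cprod α β · cprod α' β' = cprod (αα') (αβ' + α'β + ββ')`; `cprod_one_zero : cprod 1 0 = 1`.
* `N3_smul_right` (homogeneity in the third copy; first/second are in `…ThreeCopy` / `…Nested`).
* ★ `N3_cprod_cprod_cprod`: for every profile `b` and all `α β α' β' α'' β''`,
  `N3 b (cprod α β) (cprod α' β') (cprod α'' β'') = Π_i locN3 (b i) (α i) (β i) (α' i) (β' i) (α'' i) (β'' i)` with the explicit one-coordinate sum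
  `locN3 k … = Σ_{(x,y,z) ∈ {0,1}³, x+y+z = k} (α+βx)(α'+β'y)(α''+β''z)` — by induction on `d` through the slice recursion `N3_cons` and the scalar
  sections `sec_cprod`.  For cylinders (`α = 1 − 1_S`, `β = 1_S`) this is the census's per-coordinate count `C(3−r, k−r)` (`r` = number of copies
  requiring the coordinate), the starting point of the paper proof in the memo (§9) that 3C-SAHI holds for every triple of OR-events.
[this work]
-/

namespace Summit.CriticalPhenomena.PercolationContinuityZ3.Theorems.SahiThreeCopy

open Finset Function Literature.Combinatorics.Sahi2008
open scoped BigOperators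

noncomputable section

variable {d : ℕ}

/-! ### §1 Algebra of coordinate products -/

/-- Products of coordinate products are coordinate products: `(α+βx)(α'+β'x) = αα' + (αβ'+α'β+ββ')x` for `x ∈ {0,1}`. [this work] -/
theorem cprod_mul (α β α' β' : Fin d → ℝ) :
    cprod α β * cprod α' β' = cprod (fun i => α i * α' i) (fun i => α i * β' i + α' i * β i + β i * β' i) := by
  funext x
  simp only [Pi.mul_apply, cprod]
  rw [← prod_mul_distrib]
  refine prod_congr rfl fun i _ => ?_
  cases x i <;> simp; ring

/-- The constant `1` is the coordinate product with `α = 1`, `β = 0`. [this work] -/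
theorem cprod_one_zero : cprod (fun _ : Fin d => (1 : ℝ)) (fun _ => 0) = 1 := by
  funext x
  simp [cprod]

/-- `N_b` is homogeneous in the third copy. [this work] -/
theorem N3_smul_right (b : Fin d → ℕ) (c : ℝ) (f g h : Pt d → ℝ) : N3 b f g (c • h) = c * N3 b f g h := by
  rw [N3_comm13 b f g (c • h), N3_smul_left, N3_comm13 b h g f]

/-! ### §2 The one-coordinate three-copy sum and the factorisation -/

/-- The one-coordinate three-copy sum `L(k) = Σ_{x+y+z = k} (α+βx)(α'+β'y)(α''+β''z)` over `(x,y,z) ∈ {0,1}³`. [this work] -/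
def locN3 (k : ℕ) (α β α' β' α'' β'' : ℝ) : ℝ :=
  ∑ x : Bool, ∑ y : Bool, ∑ z : Bool,
    if x.toNat + y.toNat + z.toNat = k then (α + if x then β else 0) * (α' + if y then β' else 0) * (α'' + if z then β'' else 0) else 0

/-- ★ **Factorisation**: the three-copy functional of three coordinate products is the product over the coordinates of the one-coordinate
sums. [this work] -/
theorem N3_cprod_cprod_cprod : ∀ (d : ℕ) (b : Fin d → ℕ) (α β α' β' α'' β'' : Fin d → ℝ),
    N3 b (cprod α β) (cprod α' β') (cprod α'' β'') = ∏ i, locN3 (b i) (α i) (β i) (α' i) (β' i) (α'' i) (β'' i) := by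
  intro d
  induction d with
  | zero =>
    intro b α β α' β' α'' β''
    rw [N3_dim_zero]
    simp [cprod]
  | succ d ih =>
    intro b α β α' β' α'' β''
    obtain ⟨k, b', rfl⟩ : ∃ k b', b = Fin.cons k b' := ⟨b 0, Fin.tail b, (Fin.cons_self_tail b).symm⟩
    rw [N3_cons, Fin.prod_univ_succ]
    simp only [Fin.cons_zero, Fin.cons_succ]
    -- sections are scalar multiples of the tail products
    have hs : ∀ (γ δ : Fin (d + 1) → ℝ) (ε : Bool),
        sec (cprod γ δ) ε = (γ 0 + if ε then δ 0 else 0) • cprod (Fin.tail γ) (Fin.tail δ) := fun γ δ ε => sec_cprod γ δ ε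
    simp only [hs, N3_smul_left, N3_smul_mid, N3_smul_right, ih]
    have hL : locN3 k (α 0) (β 0) (α' 0) (β' 0) (α'' 0) (β'' 0) = ∑ x : Bool, ∑ y : Bool, ∑ z : Bool,
        if x.toNat + y.toNat + z.toNat = k then
          (α 0 + if x then β 0 else 0) * (α' 0 + if y then β' 0 else 0) * (α'' 0 + if z then β'' 0 else 0) else 0 := rfl
    rw [hL, sum_mul]
    refine sum_congr rfl fun ε₁ _ => ?_
    rw [sum_mul]
    refine sum_congr rfl fun ε₂ _ => ?_
    rw [sum_mul]
    refine sum_congr rfl fun ε₃ _ => ?_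
    by_cases hc : ε₁.toNat + ε₂.toNat + ε₃.toNat = k
    · rw [if_pos hc, if_pos hc]; simp only [Fin.tail]; ring
    · rw [if_neg hc, if_neg hc, zero_mul]

/-- The one-coordinate sum for a coordinate on which all three functions are CONSTANT `1` (`α = 1, β = 0`): `L(k) = C(3,k)` written out. [this work] -/
theorem locN3_one_zero (k : ℕ) : locN3 k 1 0 1 0 1 0 =
    ∑ x : Bool, ∑ y : Bool, ∑ z : Bool, if x.toNat + y.toNat + z.toNat = k then (1 : ℝ) else 0 := by
  unfold locN3
  refine sum_congr rfl fun x _ => sum_congr rfl fun y _ => sum_congr rfl fun z _ => ?_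
  split_ifs <;> simp

end

end Summit.CriticalPhenomena.PercolationContinuityZ3.Theorems.SahiThreeCopy
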